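import Summits.QuantumAdvantage.QuantumAdvantage.Theses.CubicForrelation
import Summits.QuantumAdvantage.QuantumAdvantage.Theorems.CubicForrelationSignedExactSliceIsLiftStubMoebius
import Summits.QuantumAdvantage.QuantumAdvantage.Theorems.CubicForrelationNearExactIsExactHouCubic
import Summits.QuantumAdvantage.QuantumAdvantage.Theorems.CubicForrelationNearExactIsExactAxParity
import Summits.QuantumAdvantage.QuantumAdvantage.Theorems.CubicForrelationNearExactIsExactMmNormalForm

/-!
# Small cases of `NearExactIsExact` (stmt-QuantumAdvantage-14043), part 1/4: the Walsh layer of the checker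

Fast Walsh–Hadamard transform on lists (`wal`) with its correctness (`wal_spec`), coding of the points of `𝔽₂ⁿ`
(`pt`, `codeOf`, `ptEquiv`), the real Walsh transform of the tree read on codes (`W_pt`), the capacity bound
`Φ(f,g)·2^{3m} ≤ Σ|W_g|` (`forrelation_le_cap`), bentness from the transform (`bent_of_abs`), and the soundness of
the per-function test "bent (⇒ cubic dual by Hou, ⇒ `Φ ∈ {1} ∪ [−1,3/4]`) or capacity `≤ 7·2^{3m−3}`" (`checkT_sound`).
See part 4 (`SmallCases.lean`) for the overview.  Certified-compute seat refuter-ccert-stmt-QuantumAdvantage-14043-0.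

References: Carlet 2021 §2.2.1, §6.1; Aaronson–Ambainis 2018 §1.1.1.
-/

set_option linter.dupNamespace false -- D-0017: single-problem summit ⇒ `QuantumAdvantage.QuantumAdvantage` by design

namespace Summit.QuantumAdvantage.QuantumAdvantage.Theorems.NearExactIsExact.Negative.SmallCases

open Finset
open Literature.Computability.QuantumComplexity
open Literature.Computability.QuantumComplexity.DerivativeWalsh (W fsum phi_eq_fsum fsum_eq_sum_mul_W)
open Literature.Computability.QuantumComplexity.BuzetChailloux (phi_signOf bxor bxor_comm bxor_bxor_cancel_left)
open Literature.Computability.QuantumComplexity.Simon (twist_xor_left)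
open Summit.QuantumAdvantage.QuantumAdvantage.Theorems.SignedExactSliceIsLift
  (subsets3 indic mcoeff cubicMonomials litVal monoVal evalMonos truncOf)
open Summit.QuantumAdvantage.QuantumAdvantage.Theorems.SignedExactSliceIsLift.StubMoebius
  (isDegLeFun_xor isDegLeFun_and isDegLeFun_all isDegLeFun_litVal bz_foldl_xor sum_map_filter_eq toInput_indic eval_bz
    card_support_le sum_subInd truncOf_eq)
open Summit.QuantumAdvantage.QuantumAdvantage.Theorems.CubicForrelation.NearExactIsExact
  (bb_exists_dual bb_band_of_dual_degree bb_rmWeight_holds stub_houCubic stub_axParity nf_isDegLeFun_subst)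

variable {n : ℕ}



/-- `(-1)^{[b]}` as an integer. [folklore] -/
def sgnZ (b : Bool) : ℤ := if b then -1 else 1

/-- The character `(-1)^{k·y}` on codes, read on the bits `< n`. [folklore] -/
def chi (n k y : ℕ) : ℤ := ∏ i ∈ range n, (if (k.testBit i && y.testBit i) then (-1 : ℤ) else 1)

/-- In-place fast Walsh–Hadamard transform of a list of length `2^n` (butterflies on the top bit).
[folklore] -/
def wal : ℕ → List ℤ → List ℤ
  | 0, v => v
  | n + 1, v =>
    let a := wal n (v.take (2 ^ n))
    let b := wal n (v.drop (2 ^ n))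
    List.zipWith (· + ·) a b ++ List.zipWith (· - ·) a b

/-- `wal` preserves the length `2^n`. [folklore] -/
theorem length_wal : ∀ (n : ℕ) (v : List ℤ), v.length = 2 ^ n → (wal n v).length = 2 ^ n
  | 0, v, h => h
  | n + 1, v, h => by
    have h2 : 2 ^ (n + 1) = 2 ^ n + 2 ^ n := by rw [pow_succ]; ring
    have ha : (wal n (v.take (2 ^ n))).length = 2 ^ n :=
      length_wal n _ (by rw [List.length_take, h, h2]; exact min_eq_left (Nat.le_add_right _ _))
    have hb : (wal n (v.drop (2 ^ n))).length = 2 ^ n :=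
      length_wal n _ (by rw [List.length_drop, h, h2, Nat.add_sub_cancel])
    show (List.zipWith (· + ·) (wal n (v.take (2 ^ n))) (wal n (v.drop (2 ^ n))) ++
      List.zipWith (· - ·) (wal n (v.take (2 ^ n))) (wal n (v.drop (2 ^ n)))).length = 2 ^ (n + 1)
    rw [List.length_append, List.length_zipWith, List.length_zipWith, ha, hb, min_self, h2]

/-- `chi` only reads the bits `< n`: adding `2^n` to the code does not change it. [folklore] -/
theorem chi_two_pow_add_left (n k y : ℕ) : chi n (2 ^ n + k) y = chi n k y := by
  unfold chi
  refine prod_congr rfl fun i hi => ?_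
  rw [Nat.testBit_two_pow_add_gt (mem_range.1 hi)]

/-- `chi` only reads the bits `< n` of `y`. [folklore] -/
theorem chi_two_pow_add_right (n k y : ℕ) : chi n k (2 ^ n + y) = chi n k y := by
  unfold chi
  refine prod_congr rfl fun i hi => ?_
  rw [Nat.testBit_two_pow_add_gt (mem_range.1 hi)]

/-- Splitting off the top bit of the character. [folklore] -/
theorem chi_succ (n k y : ℕ) :
    chi (n + 1) k y = chi n k y * (if (k.testBit n && y.testBit n) then (-1 : ℤ) else 1) := by
  unfold chi
  rw [prod_range_succ]

/-- **Correctness of the fast transform**: entry `y` of `wal n v` is `Σ_{k<2^n} v_k (-1)^{k·y}`. [folklore] -/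
theorem wal_spec : ∀ (n : ℕ) (v : List ℤ), v.length = 2 ^ n → ∀ y, y < 2 ^ n →
    (wal n v)[y]?.getD 0 = ∑ k ∈ range (2 ^ n), (v[k]?.getD 0) * chi n k y
  | 0, v, h, y, hy => by
    have hy0 : y = 0 := by omega
    subst hy0
    show v[0]?.getD 0 = _
    rw [pow_zero, sum_range_one]
    simp [chi]
  | n + 1, v, h, y, hy => by
    have h2 : 2 ^ (n + 1) = 2 ^ n + 2 ^ n := by rw [pow_succ]; ring
    set lo := v.take (2 ^ n) with hlo
    set hi := v.drop (2 ^ n) with hhi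
    have hlol : lo.length = 2 ^ n := by
      rw [hlo, List.length_take, h, h2]; exact min_eq_left (Nat.le_add_right _ _)
    have hhil : hi.length = 2 ^ n := by rw [hhi, List.length_drop, h, h2, Nat.add_sub_cancel]
    have ha := length_wal n lo hlol
    have hb := length_wal n hi hhil
    have elo : ∀ k, k < 2 ^ n → lo[k]?.getD 0 = v[k]?.getD 0 := fun k hk => by
      rw [hlo, List.getElem?_take, if_pos hk]
    have ehi : ∀ k, k < 2 ^ n → hi[k]?.getD 0 = v[2 ^ n + k]?.getD 0 := fun k hk => by
      rw [hhi, List.getElem?_drop]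
    -- split the right-hand side into the two halves
    have split : ∑ k ∈ range (2 ^ (n + 1)), (v[k]?.getD 0) * chi (n + 1) k y =
        ∑ k ∈ range (2 ^ n), (v[k]?.getD 0) * chi (n + 1) k y +
          ∑ k ∈ range (2 ^ n), (v[2 ^ n + k]?.getD 0) * chi (n + 1) (2 ^ n + k) y := by
      rw [h2, sum_range_add]
    show (List.zipWith (· + ·) (wal n lo) (wal n hi) ++ List.zipWith (· - ·) (wal n lo) (wal n hi))[y]?.getD 0 = _
    rw [split]
    by_cases hyl : y < 2 ^ n
    · -- first half: `a[y] + b[y]`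
      have hyn : y.testBit n = false := Nat.testBit_lt_two_pow hyl
      rw [List.getElem?_append_left (by rw [List.length_zipWith, ha, hb, min_self]; exact hyl),
        List.getElem?_zipWith, List.getElem?_eq_getElem (by rw [ha]; exact hyl),
        List.getElem?_eq_getElem (by rw [hb]; exact hyl)]
      show (wal n lo)[y] + (wal n hi)[y] = _
      have e1 := wal_spec n lo hlol y hyl
      have e2 := wal_spec n hi hhil y hyl
      rw [List.getElem?_eq_getElem (by rw [ha]; exact hyl)] at e1
      rw [List.getElem?_eq_getElem (by rw [hb]; exact hyl)] at e2
      simp only [Option.getD_some] at e1 e2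
      rw [e1, e2]
      congr 1
      · refine sum_congr rfl fun k hk => ?_
        rw [elo k (mem_range.1 hk), chi_succ, hyn, Bool.and_false]
        simp
      · refine sum_congr rfl fun k hk => ?_
        rw [ehi k (mem_range.1 hk), chi_succ, chi_two_pow_add_left, hyn, Bool.and_false]
        simp
    · -- second half: `a[y'] - b[y']`
      push Not at hyl
      obtain ⟨y', rfl⟩ : ∃ y', y = 2 ^ n + y' := ⟨y - 2 ^ n, by omega⟩
      have hy' : y' < 2 ^ n := by omega
      have hyn : (2 ^ n + y').testBit n = true := by
        rw [Nat.testBit_two_pow_add_eq, Nat.testBit_lt_two_pow hy']; rfl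
      rw [List.getElem?_append_right (by rw [List.length_zipWith, ha, hb, min_self]; omega),
        List.length_zipWith, ha, hb, min_self, Nat.add_sub_cancel_left (2 ^ n) y',
        List.getElem?_zipWith, List.getElem?_eq_getElem (by rw [ha]; exact hy'),
        List.getElem?_eq_getElem (by rw [hb]; exact hy')]
      show (wal n lo)[y'] - (wal n hi)[y'] = _
      have e1 := wal_spec n lo hlol y' hy'
      have e2 := wal_spec n hi hhil y' hy'
      rw [List.getElem?_eq_getElem (by rw [ha]; exact hy')] at e1
      rw [List.getElem?_eq_getElem (by rw [hb]; exact hy')] at e2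
      simp only [Option.getD_some] at e1 e2
      rw [e1, e2, sub_eq_add_neg, ← sum_neg_distrib]
      congr 1
      · refine sum_congr rfl fun k hk => ?_
        have hkn : k.testBit n = false := Nat.testBit_lt_two_pow (mem_range.1 hk)
        rw [elo k (mem_range.1 hk), chi_succ, chi_two_pow_add_right, hkn, Bool.false_and]
        simp
      · refine sum_congr rfl fun k hk => ?_
        have hkn : (2 ^ n + k).testBit n = true := by
          rw [Nat.testBit_two_pow_add_eq, Nat.testBit_lt_two_pow (mem_range.1 hk)]; rfl
        rw [ehi k (mem_range.1 hk), chi_succ, chi_two_pow_add_left, chi_two_pow_add_right, hkn, hyn,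
          Bool.and_self]
        simp


/-! ### Coding points of `𝔽₂ⁿ` by `k < 2^n` -/

/-- The point with code `k`: coordinate `i` is bit `i` of `k`. [folklore] -/
def pt (n k : ℕ) : Fin n → Bool := fun i => k.testBit i.val

/-- The code `Σᵢ 2^i [xᵢ]` of a point (recursive in the dimension). [folklore] -/
def codeOf : {n : ℕ} → (Fin n → Bool) → ℕ
  | 0, _ => 0
  | _ + 1, x => (x 0).toNat + 2 * codeOf (Fin.tail x)

/-- Codes are `< 2^n`. [folklore] -/
theorem codeOf_lt : ∀ {n : ℕ} (x : Fin n → Bool), codeOf x < 2 ^ n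
  | 0, _ => by simp [codeOf]
  | n + 1, x => by
    have ih := codeOf_lt (Fin.tail x)
    have hb : (x 0).toNat ≤ 1 := Bool.toNat_le (x 0)
    rw [codeOf, pow_succ]
    omega

/-- Decoding the code gives the point back. [folklore] -/
theorem pt_codeOf : ∀ {n : ℕ} (x : Fin n → Bool), pt n (codeOf x) = x
  | 0, x => funext fun i => i.elim0
  | n + 1, x => by
    have ih := pt_codeOf (Fin.tail x)
    funext i
    refine Fin.cases ?_ (fun j => ?_) i
    · show ((x 0).toNat + 2 * codeOf (Fin.tail x)).testBit 0 = x 0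
      rw [Nat.testBit_zero]
      cases x 0 <;> simp [Nat.add_mod]
    · show ((x 0).toNat + 2 * codeOf (Fin.tail x)).testBit (j.val + 1) = x j.succ
      rw [Nat.testBit_add_one]
      have e : ((x 0).toNat + 2 * codeOf (Fin.tail x)) / 2 = codeOf (Fin.tail x) := by
        have hb : (x 0).toNat ≤ 1 := Bool.toNat_le (x 0)
        omega
      rw [e]
      exact congrFun ih j

/-- Encoding the decoded point gives the code back. [folklore] -/
theorem codeOf_pt : ∀ {n : ℕ} (k : ℕ), k < 2 ^ n → codeOf (pt n k) = k
  | 0, k, hk => by simp [codeOf] ; omega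
  | n + 1, k, hk => by
    have ht : Fin.tail (pt (n + 1) k) = pt n (k / 2) := by
      funext i
      show k.testBit (i.val + 1) = (k / 2).testBit i.val
      rw [Nat.testBit_add_one]
    have ih := codeOf_pt (n := n) (k / 2) (by rw [pow_succ] at hk; omega)
    rw [codeOf, ht, ih]
    show (k.testBit 0).toNat + 2 * (k / 2) = k
    rw [Nat.testBit_zero]
    rcases Nat.mod_two_eq_zero_or_one k with h | h <;> simp [h] <;> omega

/-- The coding equivalence `Fin (2^n) ≃ 𝔽₂ⁿ`. [folklore] -/
def ptEquiv (n : ℕ) : Fin (2 ^ n) ≃ (Fin n → Bool) where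
  toFun k := pt n k
  invFun x := ⟨codeOf x, codeOf_lt x⟩
  left_inv k := Fin.ext (codeOf_pt k.val k.isLt)
  right_inv x := pt_codeOf x

/-- Sums over `𝔽₂ⁿ` as sums over codes. [folklore] -/
theorem sum_pt {M : Type*} [AddCommMonoid M] (n : ℕ) (F : (Fin n → Bool) → M) :
    ∑ x, F x = ∑ k ∈ range (2 ^ n), F (pt n k) := by
  rw [← Equiv.sum_comp (ptEquiv n)]
  exact Fin.sum_univ_eq_sum_range (fun k => F (pt n k)) (2 ^ n)

/-! ### The Walsh transform on codes -/

/-- The character on codes is the twist of the decoded points. [folklore] -/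
theorem twist_pt (n k y : ℕ) : twist (pt n k) (pt n y) = (chi n k y : ℝ) := by
  unfold twist chi
  rw [Int.cast_prod, ← Fin.prod_univ_eq_prod_range
    (fun i => (((if (k.testBit i && y.testBit i) then (-1 : ℤ) else 1) : ℤ) : ℝ)) n]
  refine prod_congr rfl fun i _ => ?_
  simp only [pt]
  split_ifs <;> simp

/-- `signOf` is the cast of `sgnZ`. [folklore] -/
theorem signOf_eq_cast (b : Bool) : signOf b = (sgnZ b : ℝ) := by
  cases b <;> simp [signOf, sgnZ]

/-- The integer Walsh transform of a Boolean function at the code `y`. [folklore] -/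
def wspec (n : ℕ) (g : (Fin n → Bool) → Bool) (y : ℕ) : ℤ :=
  ∑ k ∈ range (2 ^ n), sgnZ (g (pt n k)) * chi n k y

/-- The real Walsh transform at a decoded point is the integer one. [folklore] -/
theorem W_pt (n : ℕ) (g : (Fin n → Bool) → Bool) (y : ℕ) :
    W (fun x => signOf (g x)) (pt n y) = (wspec n g y : ℝ) := by
  unfold W wspec
  rw [sum_pt]
  push_cast
  refine sum_congr rfl fun k _ => ?_
  rw [signOf_eq_cast, twist_pt]

/-- The signed table of a Boolean function over the codes. [folklore] -/
def sigTable (n : ℕ) (g : (Fin n → Bool) → Bool) : List ℤ := (List.range (2 ^ n)).map fun k => sgnZ (g (pt n k))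

/-- The fast transform of the signed table computes `wspec`. [folklore] -/
theorem wal_sigTable (n : ℕ) (g : (Fin n → Bool) → Bool) (y : ℕ) (hy : y < 2 ^ n) :
    (wal n (sigTable n g))[y]?.getD 0 = wspec n g y := by
  rw [wal_spec n _ (by simp [sigTable]) y hy]
  refine sum_congr rfl fun k hk => ?_
  simp [sigTable, List.getElem?_range (mem_range.1 hk)]

/-! ### Bounds read off the transform -/

/-- **Capacity bound**: `Φ(f,g) · 2^{3m} ≤ Σ_y |W_g(y)|` for every `f` (`n = m + m`). [folklore] -/
theorem forrelation_le_cap (m : ℕ) (f g : (Fin (m + m) → Bool) → Bool) :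
    forrelation f g * (2 : ℝ) ^ (3 * m) ≤ ((∑ y ∈ range (2 ^ (m + m)), |wspec (m + m) g y| : ℤ) : ℝ) := by
  have hs : Real.sqrt ((2 : ℝ) ^ (3 * (m + m))) = (2 : ℝ) ^ (3 * m) := by
    rw [show (2 : ℝ) ^ (3 * (m + m)) = ((2 : ℝ) ^ (3 * m)) ^ 2 by ring, Real.sqrt_sq (by positivity)]
  have hpos : (0 : ℝ) < (2 : ℝ) ^ (3 * m) := by positivity
  rw [← phi_signOf, phi_eq_fsum, fsum_eq_sum_mul_W, hs, inv_mul_eq_div, div_mul_cancel₀ _ hpos.ne',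
    sum_pt]
  push_cast
  refine sum_le_sum fun y _ => ?_
  rw [W_pt]
  calc signOf (f (pt (m + m) y)) * (wspec (m + m) g y : ℝ) ≤ |signOf (f (pt (m + m) y)) * (wspec (m + m) g y : ℝ)| :=
        le_abs_self _
    _ = |(wspec (m + m) g y : ℝ)| := by
        rw [abs_mul]
        have : |signOf (f (pt (m + m) y))| = 1 := by unfold signOf; split_ifs <;> simp
        rw [this, one_mul]

/-- **Bentness read off the transform**: all `|W_g(y)| = 2^m` on codes gives `W_g(x)² = 2^{m+m}`. [folklore] -/
theorem bent_of_abs (m : ℕ) (g : (Fin (m + m) → Bool) → Bool)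
    (h : ∀ y, y < 2 ^ (m + m) → |wspec (m + m) g y| = 2 ^ m) :
    ∀ x, W (fun y => signOf (g y)) x ^ 2 = (2 : ℝ) ^ (m + m) := by
  intro x
  have hx := h (codeOf x) (codeOf_lt x)
  rw [← pt_codeOf x, W_pt, ← sq_abs, ← Int.cast_abs, hx]
  push_cast
  ring

/-- **Isolation at `7/8` from the transform data** (`n = m + m`, `1 ≤ m ≤ 4`): if `g` is bent on codes, Hou's
bound makes its dual cubic and the Reed–Muller distance gives `Φ = 1 ∨ Φ ≤ 3/4`; if `Σ|W_g| ≤ 7·2^{3m−3}`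
the capacity bound gives `Φ ≤ 7/8`. Either way `7/8 < Φ(f,g) ⇒ Φ(f,g) = 1` for cubic `f`, `g`. [folklore] -/
theorem isolation_of_transform (m : ℕ) (hm1 : 1 ≤ m) (hm4 : m ≤ 4) (f g : (Fin (m + m) → Bool) → Bool)
    (hf : IsDegLeFun 3 f) (hg : IsDegLeFun 3 g)
    (h : (∀ y, y < 2 ^ (m + m) → |wspec (m + m) g y| = 2 ^ m) ∨
      ∑ y ∈ range (2 ^ (m + m)), |wspec (m + m) g y| ≤ 7 * 2 ^ (3 * m - 3))
    (hlt : 7 / 8 < forrelation f g) : forrelation f g = 1 := by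
  rcases h with hb | hc
  · obtain ⟨d, hd⟩ := bb_exists_dual (bent_of_abs m g hb)
    have hdeg : IsDegLeFun 3 d :=
      (stub_houCubic stub_axParity m g d hg hd).mono (by omega)
    rcases bb_band_of_dual_degree bb_rmWeight_holds m 3 f g d hf hdeg hd with h1 | h1
    · exact h1
    · norm_num at h1; linarith
  · exfalso
    have hcap := forrelation_le_cap m f g
    have hc' : (((∑ y ∈ range (2 ^ (m + m)), |wspec (m + m) g y| : ℤ)) : ℝ) ≤ 7 * (2 : ℝ) ^ (3 * m - 3) := by
      exact_mod_cast hc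
    have e : (2 : ℝ) ^ (3 * m) = 8 * (2 : ℝ) ^ (3 * m - 3) := by
      rw [show (8 : ℝ) = 2 ^ 3 by norm_num, ← pow_add]; congr 1; omega
    have hpos : (0 : ℝ) < (2 : ℝ) ^ (3 * m - 3) := by positivity
    nlinarith

/-! ### The per-function check -/

/-- The per-function check for `n = m + m`: bent on codes (all `|W| = 2^m`) or capacity `Σ|W| ≤ 7·2^{3m−3}`. -/
def checkT (m : ℕ) (v : List ℤ) : Bool :=
  let ws := (wal (m + m) v).map Int.natAbs
  ws.all (fun w => w == 2 ^ m) || decide (ws.sum ≤ 7 * 2 ^ (3 * m - 3))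

/-- Sum of a mapped list as a sum over indices. [folklore] -/
theorem sum_map_eq_sum_range {α : Type*} (l : List α) (d : α) (F : α → ℕ) :
    (l.map F).sum = ∑ i ∈ range l.length, F (l[i]?.getD d) := by
  induction l with
  | nil => simp
  | cons a l ih =>
    rw [List.map_cons, List.sum_cons, List.length_cons, sum_range_succ', ih]
    simp [add_comm]

/-- **Soundness of the per-function check.** [folklore] -/
theorem checkT_sound (m : ℕ) (hm1 : 1 ≤ m) (hm4 : m ≤ 4) (g : (Fin (m + m) → Bool) → Bool)
    (hc : checkT m (sigTable (m + m) g) = true) :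
    ∀ f : (Fin (m + m) → Bool) → Bool, IsDegLeFun 3 f → IsDegLeFun 3 g →
      7 / 8 < forrelation f g → forrelation f g = 1 := by
  intro f hf hg hlt
  refine isolation_of_transform m hm1 hm4 f g hf hg ?_ hlt
  have hlen : (wal (m + m) (sigTable (m + m) g)).length = 2 ^ (m + m) := length_wal _ _ (by simp [sigTable])
  simp only [checkT, Bool.or_eq_true, List.all_eq_true, beq_iff_eq, decide_eq_true_eq] at hc
  rcases hc with hb | hs
  · left
    intro y hy
    have hmem : Int.natAbs ((wal (m + m) (sigTable (m + m) g))[y]?.getD 0) ∈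
        (wal (m + m) (sigTable (m + m) g)).map Int.natAbs := by
      rw [List.getElem?_eq_getElem (by rw [hlen]; exact hy), Option.getD_some]
      exact List.mem_map.2 ⟨_, List.getElem_mem _, rfl⟩
    have e := hb _ hmem
    rw [wal_sigTable _ _ _ hy] at e
    rw [Int.abs_eq_natAbs, e]
    push_cast
    rfl
  · right
    rw [sum_map_eq_sum_range _ 0, hlen] at hs
    have e : ∑ y ∈ range (2 ^ (m + m)), |wspec (m + m) g y| =
        ((∑ i ∈ range (2 ^ (m + m)), ((wal (m + m) (sigTable (m + m) g))[i]?.getD 0).natAbs : ℕ) : ℤ) := by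
      push_cast
      refine sum_congr rfl fun y hy => ?_
      rw [← wal_sigTable _ _ _ (mem_range.1 hy), Int.abs_eq_natAbs]
    rw [e]
    exact_mod_cast hs



end Summit.QuantumAdvantage.QuantumAdvantage.Theorems.NearExactIsExact.Negative.SmallCases
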